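import Summits.CriticalPhenomena.Ising3D.Control2DIsingSpectrum
import Summits.CriticalPhenomena.Ising3D.Control2DVertexNonVacuity
import Mathlib.Analysis.Convex.Basic
import Mathlib.Tactic.Linarith
import Mathlib.Tactic.NormNum
import Mathlib.Tactic.FieldSimp
import Mathlib.Tactic.Ring
import HarnessLib

/-!
# Mixtures of crossing data: the typed hypothesis class of the 2D control is convex
(cell `pub-ising3x`, seat controls-1 gen 40; PAPER §6.7 / Appendix E — CONTROL-ONLY)

HONEST FRAMING: lottery ticket; floor = tightest certified 3D Ising CFT bounds; no exact-solution
claim without a proof. CONTROL-ONLY (`d = 2`, global `sl(2) × sl(2)` blocks, `Δ_σ = 1/8` an INPUT, axiom set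
`A2D′`); nothing here is about `d = 3`, no certificate, functional or number of the record is touched, and no
new hypothesis or named fact enters.

WHAT THIS FILE ADDS. Every typed statement of the 2D control quantifies over `D : CrossingData` with
`D.IsUnitary ∧ D.SatisfiesCrossing s` (+ spectrum clauses). That class is closed under MIXTURES:

* `CrossingData.mix D₁ D₂ t` — the disjoint union of the two label sets with squared OPE coefficients
  `t · p₁` and `(1 - t) · p₂` (the block data of the four-point function `t 𝒢₁ + (1 - t) 𝒢₂`, i.e. of the
  operator `σ₁ ⊕ σ₂` in a direct-sum theory — the sum rule sees neither locality nor a unique vacuum);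
  `mix_isUnitary` (`t ∈ [0,1]`), `mix_satisfiesCrossing` (every `t`: the sum rule is affine in `p`),
  `mix_scalarsIn` / `mix_spinTwoIn` (unions), `mix_hasScalarGap` (minimum), `mix_stressCoeff` and
  `mix_boxCoeff` (`t c₁ + (1-t) c₂`, the summability bookkeeping explicit); hence the sets of realised total `(2,2)` coefficients over the gap class and over the
  `A2D′` box class of `CTwoSided` are CONVEX (`convex_stressCoeffs_gap`, `convex_stressCoeffs_box`).
* The Ising–free-boson family at the control column, `isingBosonMix t = mix isingData2D (vertexData2D (1/8)) t`:
  for every `t ∈ [0,1]` a unitary solution of the `⟨σσσσ⟩` sum rule at `Δ_σ = 1/8` WITH a stress tensor,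
  scalars in `{1/2, 1} ∪ [2, ∞)` (gap `1/2`), spin 2 in `{2} ∪ [5/2, ∞)`, total `(2,2)` coefficient `(1+t)/128`
  (`isingBosonMix_stressCoeff`) — so EVERY Ward central charge `c ∈ [1/2, 1]` is realised in the class
  {unitary, crossing at `1/8`, scalar gap `1/2`, stress tensor, spin-2 gap `5/2`} (`wardCentralCharge_realised`):
  unitarity + crossing + a stress tensor + these gaps do NOT determine `c` at this column. The mixtures carry TWO
  sub-gap scalars (`1/2` and `1`), so no single-location clause `ScalarsIn ({x} ∪ [2,∞))` holds for them
  (`isingBosonMix_not_oneLocation`): the class-1 statements `ExcludedAt` / `TwoSided` are silent about such data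
  by design (cf. the WARNING in `Control2DIsland`). The consequences for the clauses of `A2D′` that the certified
  record needs are drawn in `Control2DClauseLedger`.

NOT claimed: uniqueness (`A = {1}`), anything three-dimensional, any new bound.

References: R. Rattazzi, V. S. Rychkov, E. Tonni, A. Vichi, JHEP 12 (2008) 031, §3 eq. (3.6), §5
[cite: RattazziEtAl2008, §5]; A. A. Belavin, A. M. Polyakov, A. B. Zamolodchikov, Nucl. Phys. B 241 (1984) 333
[cite: BelavinPolyakovZamolodchikov1984, §3]; Ph. Di Francesco, P. Mathieu, D. Sénéchal, Conformal Field Theory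
(Springer 1997), §9.1 [cite: DiFrancescoMathieuSenechal1997, §9.1]. Tree: `CrossingData`, `IsUnitary`,
`SatisfiesCrossing`, `HasScalarGap` (`Control2DBootstrap`); `ScalarsIn`, `SpinTwoIn` (`Control2DIsland`);
`stressSet`, `stressCoeff` (`Control2DOpeTwoSided`); `boxSet`, `boxCoeff` (`Control2DOpeEpsTwoSided`); `isingData2D` + spectrum (`Control2DIsingData/Spectrum`);
`vertexData2D` + spectrum (`Control2DVertexData/NonVacuity`). Mathlib: `HasSum.sum`, `hasSum_single`, `Convex`.
-/

namespace Summit.CriticalPhenomena.Ising3D.Control2D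

open Set
open Literature.MathematicalPhysics.QuantumFieldTheory.ConformalBootstrap3D

/-! ### Mixtures -/

namespace CrossingData

/-- **Mixture of two crossing data** with weight `t`: labels `ι₁ ⊕ ι₂`, the same `(Δ, ℓ)`, squared OPE
coefficients `t · p₁` on the first summand and `(1 - t) · p₂` on the second — the block data of
`t 𝒢₁ + (1 - t) 𝒢₂`. [cite: RattazziEtAl2008, §3 eq. (3.6)] -/
noncomputable def mix (D₁ D₂ : CrossingData) (t : ℝ) : CrossingData where
  ι := D₁.ι ⊕ D₂.ι
  Δ := Sum.elim D₁.Δ D₂.Δ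
  spin := Sum.elim D₁.spin D₂.spin
  p := Sum.elim (fun i => t * D₁.p i) (fun j => (1 - t) * D₂.p j)

variable {D₁ D₂ : CrossingData} {t s : ℝ}

/-- `Δ` on the first summand. [folklore] -/
@[simp] theorem mix_Δ_inl (i : D₁.ι) : (D₁.mix D₂ t).Δ (Sum.inl i) = D₁.Δ i := rfl
/-- `Δ` on the second summand. [folklore] -/
@[simp] theorem mix_Δ_inr (j : D₂.ι) : (D₁.mix D₂ t).Δ (Sum.inr j) = D₂.Δ j := rfl
/-- `ℓ` on the first summand. [folklore] -/
@[simp] theorem mix_spin_inl (i : D₁.ι) : (D₁.mix D₂ t).spin (Sum.inl i) = D₁.spin i := rfl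
/-- `ℓ` on the second summand. [folklore] -/
@[simp] theorem mix_spin_inr (j : D₂.ι) : (D₁.mix D₂ t).spin (Sum.inr j) = D₂.spin j := rfl
/-- `p` on the first summand. [folklore] -/
@[simp] theorem mix_p_inl (i : D₁.ι) : (D₁.mix D₂ t).p (Sum.inl i) = t * D₁.p i := rfl
/-- `p` on the second summand. [folklore] -/
@[simp] theorem mix_p_inr (j : D₂.ι) : (D₁.mix D₂ t).p (Sum.inr j) = (1 - t) * D₂.p j := rfl

/-- **Unitarity is preserved** for weights `0 ≤ t ≤ 1` (even spins and `Δ ≥ ℓ` are inherited; `p ≥ 0`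
is scaled by non-negative numbers). [folklore] -/
theorem mix_isUnitary (h₁ : D₁.IsUnitary) (h₂ : D₂.IsUnitary) (ht₀ : 0 ≤ t) (ht₁ : t ≤ 1) :
    (D₁.mix D₂ t).IsUnitary := by
  rintro (i | j)
  · obtain ⟨he, hΔ, hp⟩ := h₁ i
    exact ⟨he, hΔ, mul_nonneg ht₀ hp⟩
  · obtain ⟨he, hΔ, hp⟩ := h₂ j
    exact ⟨he, hΔ, mul_nonneg (by linarith) hp⟩

/-- **Crossing is preserved for EVERY weight.** The sum rule `∑ p F = -F_𝟙` is LINEAR in the squared OPE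
coefficients: the sum rule of the mixture is the `t` / `(1 - t)` combination of the two `HasSum`s
(`HasSum.mul_left`, then `HasSum.sum` over `ι₁ ⊕ ι₂`), with value `t (-F_𝟙) + (1 - t)(-F_𝟙) = -F_𝟙`. This is why
the hypothesis class of every 2D statement of record is convex: the sum rule is linear in the `p`'s and blind to
locality and to a unique vacuum. [cite: RattazziEtAl2008, §3 eq. (3.6)] -/
theorem mix_satisfiesCrossing (h₁ : D₁.SatisfiesCrossing s) (h₂ : D₂.SatisfiesCrossing s) (t : ℝ) :
    (D₁.mix D₂ t).SatisfiesCrossing s := by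
  intro z zb hz hzb
  have A := (h₁ z zb hz hzb).mul_left t
  have B := (h₂ z zb hz hzb).mul_left (1 - t)
  have hA : HasSum ((fun i : (D₁.mix D₂ t).ι => (D₁.mix D₂ t).p i *
      crossF s (-1) (globalBlock ((D₁.mix D₂ t).Δ i) ((D₁.mix D₂ t).spin i)) z zb) ∘ Sum.inl)
      (t * -(crossF s (-1) (fun _ _ => (1 : ℝ)) z zb)) := by
    refine A.congr_fun fun i => ?_
    simp only [Function.comp_apply, mix_p_inl, mix_Δ_inl, mix_spin_inl, mul_assoc]
  have hB : HasSum ((fun i : (D₁.mix D₂ t).ι => (D₁.mix D₂ t).p i *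
      crossF s (-1) (globalBlock ((D₁.mix D₂ t).Δ i) ((D₁.mix D₂ t).spin i)) z zb) ∘ Sum.inr)
      ((1 - t) * -(crossF s (-1) (fun _ _ => (1 : ℝ)) z zb)) := by
    refine B.congr_fun fun j => ?_
    simp only [Function.comp_apply, mix_p_inr, mix_Δ_inr, mix_spin_inr, mul_assoc]
  have AB := HasSum.sum hA hB
  have hval : t * -(crossF s (-1) (fun _ _ => (1 : ℝ)) z zb) +
      (1 - t) * -(crossF s (-1) (fun _ _ => (1 : ℝ)) z zb) = -(crossF s (-1) (fun _ _ => (1 : ℝ)) z zb) := by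
    ring
  rw [hval] at AB
  exact AB

/-- **Scalar content of a mixture** = union of the scalar contents. [folklore] -/
theorem mix_scalarsIn {S₁ S₂ : Set ℝ} (h₁ : D₁.ScalarsIn S₁) (h₂ : D₂.ScalarsIn S₂) (t : ℝ) :
    (D₁.mix D₂ t).ScalarsIn (S₁ ∪ S₂) := by
  rintro (i | j) hi
  · exact Or.inl (h₁ i hi)
  · exact Or.inr (h₂ j hi)

/-- **Spin-2 content of a mixture** = union of the spin-2 contents. [folklore] -/
theorem mix_spinTwoIn {S₁ S₂ : Set ℝ} (h₁ : D₁.SpinTwoIn S₁) (h₂ : D₂.SpinTwoIn S₂) (t : ℝ) :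
    (D₁.mix D₂ t).SpinTwoIn (S₁ ∪ S₂) := by
  rintro (i | j) hi
  · exact Or.inl (h₁ i hi)
  · exact Or.inr (h₂ j hi)

/-- **Scalar gap of a mixture** = the smaller gap. [folklore] -/
theorem mix_hasScalarGap {U₁ U₂ : ℝ} (h₁ : D₁.HasScalarGap U₁) (h₂ : D₂.HasScalarGap U₂) (t : ℝ) :
    (D₁.mix D₂ t).HasScalarGap (min U₁ U₂) := by
  rintro (i | j) hi
  · exact (min_le_left _ _).trans (h₁ i hi)
  · exact (min_le_right _ _).trans (h₂ j hi)

/-- The `(2,2)`-indicator of `p` on the first summand is `t` times that of `D₁`. [folklore] -/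
theorem mix_stress_indicator_inl (i : D₁.ι) :
    (D₁.mix D₂ t).stressSet.indicator (D₁.mix D₂ t).p (Sum.inl i) = t * D₁.stressSet.indicator D₁.p i := by
  by_cases h : i ∈ D₁.stressSet
  · have h' : (Sum.inl i : (D₁.mix D₂ t).ι) ∈ (D₁.mix D₂ t).stressSet := h
    exact (Set.indicator_of_mem h' _).trans (by rw [Set.indicator_of_mem h]; rfl)
  · have h' : (Sum.inl i : (D₁.mix D₂ t).ι) ∉ (D₁.mix D₂ t).stressSet := h
    exact (Set.indicator_of_notMem h' _).trans (by rw [Set.indicator_of_notMem h, mul_zero])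

/-- The `(2,2)`-indicator of `p` on the second summand is `(1 - t)` times that of `D₂`. [folklore] -/
theorem mix_stress_indicator_inr (j : D₂.ι) :
    (D₁.mix D₂ t).stressSet.indicator (D₁.mix D₂ t).p (Sum.inr j) =
      (1 - t) * D₂.stressSet.indicator D₂.p j := by
  by_cases h : j ∈ D₂.stressSet
  · have h' : (Sum.inr j : (D₁.mix D₂ t).ι) ∈ (D₁.mix D₂ t).stressSet := h
    exact (Set.indicator_of_mem h' _).trans (by rw [Set.indicator_of_mem h]; rfl)
  · have h' : (Sum.inr j : (D₁.mix D₂ t).ι) ∉ (D₁.mix D₂ t).stressSet := h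
    exact (Set.indicator_of_notMem h' _).trans (by rw [Set.indicator_of_notMem h, mul_zero])

/-- **The `(2,2)`-indicator of a mixture sums to `t c₁ + (1 - t) c₂`** when both summands' indicators are
summable (always the case for data with finitely many labels at `(2,2)`). [folklore] -/
theorem mix_hasSum_stress (h₁ : Summable (D₁.stressSet.indicator D₁.p))
    (h₂ : Summable (D₂.stressSet.indicator D₂.p)) (t : ℝ) :
    HasSum ((D₁.mix D₂ t).stressSet.indicator (D₁.mix D₂ t).p)
      (t * D₁.stressCoeff + (1 - t) * D₂.stressCoeff) := by
  have A : HasSum (((D₁.mix D₂ t).stressSet.indicator (D₁.mix D₂ t).p) ∘ Sum.inl) (t * D₁.stressCoeff) := by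
    refine (h₁.hasSum.mul_left t).congr_fun fun i => ?_
    simp only [Function.comp_apply, mix_stress_indicator_inl]
  have B : HasSum (((D₁.mix D₂ t).stressSet.indicator (D₁.mix D₂ t).p) ∘ Sum.inr)
      ((1 - t) * D₂.stressCoeff) := by
    refine (h₂.hasSum.mul_left (1 - t)).congr_fun fun j => ?_
    simp only [Function.comp_apply, mix_stress_indicator_inr]
  exact HasSum.sum A B

/-- **Total `(2,2)` coefficient of a mixture**: `p_T(mix) = t p_T(D₁) + (1 - t) p_T(D₂)`. [folklore] -/
theorem mix_stressCoeff (h₁ : Summable (D₁.stressSet.indicator D₁.p))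
    (h₂ : Summable (D₂.stressSet.indicator D₂.p)) (t : ℝ) :
    (D₁.mix D₂ t).stressCoeff = t * D₁.stressCoeff + (1 - t) * D₂.stressCoeff :=
  (mix_hasSum_stress h₁ h₂ t).tsum_eq

/-- The in-box indicator of `p` on the first summand is `t` times that of `D₁` (same box). [folklore] -/
theorem mix_box_indicator_inl (e₁ e₂ : ℝ) (i : D₁.ι) :
    ((D₁.mix D₂ t).boxSet e₁ e₂).indicator (D₁.mix D₂ t).p (Sum.inl i) =
      t * (D₁.boxSet e₁ e₂).indicator D₁.p i := by
  by_cases h : i ∈ D₁.boxSet e₁ e₂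
  · have h' : (Sum.inl i : (D₁.mix D₂ t).ι) ∈ (D₁.mix D₂ t).boxSet e₁ e₂ := h
    exact (Set.indicator_of_mem h' _).trans (by rw [Set.indicator_of_mem h]; rfl)
  · have h' : (Sum.inl i : (D₁.mix D₂ t).ι) ∉ (D₁.mix D₂ t).boxSet e₁ e₂ := h
    exact (Set.indicator_of_notMem h' _).trans (by rw [Set.indicator_of_notMem h, mul_zero])

/-- The in-box indicator of `p` on the second summand is `(1 - t)` times that of `D₂`. [folklore] -/
theorem mix_box_indicator_inr (e₁ e₂ : ℝ) (j : D₂.ι) :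
    ((D₁.mix D₂ t).boxSet e₁ e₂).indicator (D₁.mix D₂ t).p (Sum.inr j) =
      (1 - t) * (D₂.boxSet e₁ e₂).indicator D₂.p j := by
  by_cases h : j ∈ D₂.boxSet e₁ e₂
  · have h' : (Sum.inr j : (D₁.mix D₂ t).ι) ∈ (D₁.mix D₂ t).boxSet e₁ e₂ := h
    exact (Set.indicator_of_mem h' _).trans (by rw [Set.indicator_of_mem h]; rfl)
  · have h' : (Sum.inr j : (D₁.mix D₂ t).ι) ∉ (D₁.mix D₂ t).boxSet e₁ e₂ := h
    exact (Set.indicator_of_notMem h' _).trans (by rw [Set.indicator_of_notMem h, mul_zero])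

/-- **Total in-box coefficient of a mixture**: `p_box(mix) = t p_box(D₁) + (1 - t) p_box(D₂)` (same box; both
in-box indicators summable). [folklore] -/
theorem mix_boxCoeff {e₁ e₂ : ℝ} (h₁ : Summable ((D₁.boxSet e₁ e₂).indicator D₁.p))
    (h₂ : Summable ((D₂.boxSet e₁ e₂).indicator D₂.p)) (t : ℝ) :
    (D₁.mix D₂ t).boxCoeff e₁ e₂ = t * D₁.boxCoeff e₁ e₂ + (1 - t) * D₂.boxCoeff e₁ e₂ := by
  have A : HasSum ((((D₁.mix D₂ t).boxSet e₁ e₂).indicator (D₁.mix D₂ t).p) ∘ Sum.inl)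
      (t * D₁.boxCoeff e₁ e₂) := by
    refine (h₁.hasSum.mul_left t).congr_fun fun i => ?_
    simp only [Function.comp_apply, mix_box_indicator_inl]
  have B : HasSum ((((D₁.mix D₂ t).boxSet e₁ e₂).indicator (D₁.mix D₂ t).p) ∘ Sum.inr)
      ((1 - t) * D₂.boxCoeff e₁ e₂) := by
    refine (h₂.hasSum.mul_left (1 - t)).congr_fun fun j => ?_
    simp only [Function.comp_apply, mix_box_indicator_inr]
  exact (HasSum.sum A B).tsum_eq

end CrossingData

/-! ### Convexity of the realised `(2,2)` coefficients -/

/-- **The realised total `(2,2)` coefficients over the gap class form a convex set**: with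
`Q(s, U) = {p_T(D) : D unitary, crossing at s, scalar gap U, (2,2)-indicator summable}`, `Q` is convex
(mix the two data with weights `a`, `b`). [folklore] -/
theorem convex_stressCoeffs_gap (s U : ℝ) :
    Convex ℝ {q : ℝ | ∃ D : CrossingData, D.IsUnitary ∧ D.SatisfiesCrossing s ∧ D.HasScalarGap U ∧
      Summable (D.stressSet.indicator D.p) ∧ D.stressCoeff = q} := by
  intro q₁ hq₁ q₂ hq₂ a b ha hb hab
  obtain ⟨D₁, hU₁, hC₁, hG₁, hS₁, rfl⟩ := hq₁
  obtain ⟨D₂, hU₂, hC₂, hG₂, hS₂, rfl⟩ := hq₂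
  have hb' : b = 1 - a := by linarith
  refine ⟨D₁.mix D₂ a, CrossingData.mix_isUnitary hU₁ hU₂ ha (by linarith),
    CrossingData.mix_satisfiesCrossing hC₁ hC₂ a, ?_, (CrossingData.mix_hasSum_stress hS₁ hS₂ a).summable, ?_⟩
  · simpa using CrossingData.mix_hasScalarGap hG₁ hG₂ a
  · rw [CrossingData.mix_stressCoeff hS₁ hS₂ a, hb', smul_eq_mul, smul_eq_mul]

/-- **The realised total `(2,2)` coefficients over the `A2D′` box class form a convex set**: the class of
`CTwoSided s G δ e₁ e₂ · ·` (scalars in `[e₁, e₂] ∪ [G, ∞)`, spin 2 in `{2} ∪ [2+δ, ∞)`) is closed under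
mixtures, so its realised `p_T` values (hence the realised Ward central charges `s²/(2 p_T)`, an interval's image
under a monotone map) form a convex set. [folklore] -/
theorem convex_stressCoeffs_box (s G δ e₁ e₂ : ℝ) :
    Convex ℝ {q : ℝ | ∃ D : CrossingData, D.IsUnitary ∧ D.SatisfiesCrossing s ∧
      D.ScalarsIn (Icc e₁ e₂ ∪ Ici G) ∧ D.SpinTwoIn ({2} ∪ Ici (2 + δ)) ∧
      Summable (D.stressSet.indicator D.p) ∧ D.stressCoeff = q} := by
  intro q₁ hq₁ q₂ hq₂ a b ha hb hab
  obtain ⟨D₁, hU₁, hC₁, hSc₁, hT₁, hS₁, rfl⟩ := hq₁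
  obtain ⟨D₂, hU₂, hC₂, hSc₂, hT₂, hS₂, rfl⟩ := hq₂
  have hb' : b = 1 - a := by linarith
  refine ⟨D₁.mix D₂ a, CrossingData.mix_isUnitary hU₁ hU₂ ha (by linarith),
    CrossingData.mix_satisfiesCrossing hC₁ hC₂ a, ?_, ?_,
    (CrossingData.mix_hasSum_stress hS₁ hS₂ a).summable, ?_⟩
  · simpa using CrossingData.mix_scalarsIn hSc₁ hSc₂ a
  · simpa using CrossingData.mix_spinTwoIn hT₁ hT₂ a
  · rw [CrossingData.mix_stressCoeff hS₁ hS₂ a, hb', smul_eq_mul, smul_eq_mul]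

/-! ### The Ising–free-boson family at the control column `Δ_σ = 1/8` -/

/-- **The Ising–free-boson mixture** at `Δ_σ = 1/8`: weight `t` on the 2D Ising datum (`c = 1/2`, `Δ_ε = 1`),
weight `1 - t` on the free-boson vertex datum `√2 cos(αφ)` of dimension `1/8` (`c = 1`, sub-gap scalar at `1/2`).
[cite: DiFrancescoMathieuSenechal1997, §9.1] -/
noncomputable def isingBosonMix (t : ℝ) : CrossingData :=
  isingData2D.mix (vertexData2D (1 / 8)) t

/-- The family is unitary for `t ∈ [0, 1]`. [folklore] -/
theorem isingBosonMix_isUnitary {t : ℝ} (ht : t ∈ Icc (0 : ℝ) 1) : (isingBosonMix t).IsUnitary :=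
  CrossingData.mix_isUnitary isingData2D_isUnitary (vertexData2D_isUnitary (by norm_num)) ht.1 ht.2

/-- The family solves the `⟨σσσσ⟩` sum rule at `Δ_σ = 1/8` (every `t`). [cite: RattazziEtAl2008, §3 eq. (3.6)] -/
theorem isingBosonMix_satisfiesCrossing (t : ℝ) : (isingBosonMix t).SatisfiesCrossing (1 / 8) :=
  CrossingData.mix_satisfiesCrossing isingData2D_satisfiesCrossing
    (vertexData2D_satisfiesCrossing (s := 1 / 8) (by norm_num)) t

/-- **Scalars of the family**: `{1/2, 1} ∪ [2, ∞)` (Ising: `{1} ∪ [4,∞)`; boson: `{1/2} ∪ [2,∞)`). [folklore] -/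
theorem isingBosonMix_scalarsIn (t : ℝ) : (isingBosonMix t).ScalarsIn ({1 / 2, 1} ∪ Ici 2) := by
  have h := CrossingData.mix_scalarsIn isingData2D_scalarsIn (vertexData2D_scalarsIn (s := 1 / 8) (by norm_num)) t
  intro i hi
  rcases h i hi with (h1 | h1) | (h1 | h1)
  · left; right; exact h1
  · right; exact le_trans (by norm_num) (mem_Ici.mp h1)
  · left; left; rw [mem_singleton_iff] at h1; exact h1.trans (by norm_num)
  · right; exact h1

/-- **Scalar gap of the family**: `1/2`. [folklore] -/
theorem isingBosonMix_hasScalarGap (t : ℝ) : (isingBosonMix t).HasScalarGap (1 / 2) := by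
  intro i hi
  rcases isingBosonMix_scalarsIn t i hi with h | h
  · rcases h with h | h
    · rw [h]
    · rw [mem_singleton_iff] at h; rw [h]; norm_num
  · exact le_trans (by norm_num) (mem_Ici.mp h)

/-- **Spin-2 content of the family**: `{2} ∪ [5/2, ∞)` (both carry a stress tensor at `2`; Ising's next spin-2
quasi-primary is typed at `≥ 3`, the boson's charge family starts at `4·(1/8) + 2 = 5/2`). [folklore] -/
theorem isingBosonMix_spinTwoIn (t : ℝ) : (isingBosonMix t).SpinTwoIn ({2} ∪ Ici (5 / 2)) := by
  have h := CrossingData.mix_spinTwoIn isingData2D_spinTwoIn (vertexData2D_spinTwoIn (1 / 8)) t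
  intro i hi
  rcases h i hi with (h1 | h1) | (h1 | h1)
  · exact Or.inl h1
  · right; exact le_trans (by norm_num) (mem_Ici.mp h1)
  · exact Or.inl h1
  · right
    have h2 : (2 : ℝ) + min 2 (4 * (1 / 8)) ≤ (isingBosonMix t).Δ i := h1
    rw [show (2 : ℝ) + min 2 (4 * (1 / 8)) = 5 / 2 by norm_num] at h2
    exact h2

/-- The Ising datum's `(2,2)`-indicator is summable (one label). [folklore] -/
theorem isingData2D_stress_summable : Summable (isingData2D.stressSet.indicator isingData2D.p) :=
  (hasSum_single _ isingData2D_stress_indicator_of_ne).summable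

/-- The boson datum's `(2,2)`-indicator is summable (one label; `s > 0`). [folklore] -/
theorem vertexData2D_stress_summable {s : ℝ} (hs : 0 < s) :
    Summable ((vertexData2D s).stressSet.indicator (vertexData2D s).p) :=
  (hasSum_single _ (vertexData2D_stress_indicator_of_ne hs)).summable

/-- **Total `(2,2)` coefficient of the family**: `p_T(t) = t/64 + (1-t)/128 = (1+t)/128`. [folklore] -/
theorem isingBosonMix_stressCoeff (t : ℝ) : (isingBosonMix t).stressCoeff = (1 + t) / 128 := by
  unfold isingBosonMix
  rw [CrossingData.mix_stressCoeff isingData2D_stress_summable (vertexData2D_stress_summable (by norm_num)) t,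
    isingData2D_stressCoeff, vertexData2D_stressCoeff (by norm_num)]
  ring

/-- The family carries a stress tensor: a label at `(Δ, ℓ) = (2, 2)` with coefficient `t/64` (Ising's `T ⊕ T̄`;
the boson's carries `(1-t)/128`). [cite: BelavinPolyakovZamolodchikov1984, §3] -/
theorem isingBosonMix_stressLabel (t : ℝ) :
    (isingBosonMix t).Δ (Sum.inl (Sum.inl isingStressLabel)) = 2 ∧
      (isingBosonMix t).spin (Sum.inl (Sum.inl isingStressLabel)) = 2 ∧
        (isingBosonMix t).p (Sum.inl (Sum.inl isingStressLabel)) = t / 64 := by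
  obtain ⟨h1, h2, h3⟩ := isingData2D_stressLabel
  refine ⟨h1, h2, ?_⟩
  show t * isingData2D.p (Sum.inl isingStressLabel) = t / 64
  rw [h3]; ring

/-- **Every Ward central charge `c ∈ [1/2, 1]` is realised at the control column** by a unitary solution of the
`⟨σσσσ⟩` sum rule at `Δ_σ = 1/8` with scalar gap `1/2`, a stress tensor, spin 2 in `{2} ∪ [5/2, ∞)` and total
`(2,2)` coefficient equal to the Ward value `(1/8)²/(2c)`: take `t = 1/c - 1` in the Ising–free-boson family.
So unitarity + crossing + a stress tensor + gap `1/2` + spin-2 gap `5/2` do NOT determine `c` at this column; the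
record's `c` interval rests on the `A2D′` clauses. CONTROL-ONLY. [cite: BelavinPolyakovZamolodchikov1984, §3] -/
theorem wardCentralCharge_realised {c : ℝ} (hc : c ∈ Icc (1 / 2 : ℝ) 1) :
    ∃ D : CrossingData, D.IsUnitary ∧ D.SatisfiesCrossing (1 / 8) ∧ D.HasScalarGap (1 / 2) ∧
      D.ScalarsIn ({1 / 2, 1} ∪ Ici 2) ∧ D.SpinTwoIn ({2} ∪ Ici (5 / 2)) ∧
      (∃ i, D.Δ i = 2 ∧ D.spin i = 2) ∧ D.stressCoeff = (1 / 8 : ℝ) ^ 2 / (2 * c) := by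
  obtain ⟨hc₁, hc₂⟩ := hc
  have hc0 : 0 < c := by linarith
  refine ⟨isingBosonMix (1 / c - 1), isingBosonMix_isUnitary ⟨?_, ?_⟩, isingBosonMix_satisfiesCrossing _,
    isingBosonMix_hasScalarGap _, isingBosonMix_scalarsIn _, isingBosonMix_spinTwoIn _,
    ⟨_, (isingBosonMix_stressLabel _).1, (isingBosonMix_stressLabel _).2.1⟩, ?_⟩
  · rw [sub_nonneg, le_div_iff₀ hc0]; linarith
  · rw [sub_le_iff_le_add, div_le_iff₀ hc0]; linarith
  · rw [isingBosonMix_stressCoeff]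
    field_simp
    ring

/-- The lowest charge-sector label `(k, l) = (0, 0)` of the vertex datum: the scalar `√2 cos(2αφ)` at `Δ = 4s`.
[cite: DiFrancescoMathieuSenechal1997, §9.1] -/
def vtxChargeLabel : VtxChLabel := ⟨(0, 0), le_rfl⟩

/-- **The mixtures carry TWO sub-gap scalars** (`1/2` and `1`), so no single-location clause
`ScalarsIn ({x} ∪ [2, ∞))` holds for them: the class-1 statements (`ExcludedAt`, `TwoSided`) are silent about
such data by design (cf. the WARNING of `Control2DIsland`). [folklore] -/
theorem isingBosonMix_not_oneLocation (t : ℝ) : ¬ ∃ x : ℝ, (isingBosonMix t).ScalarsIn ({x} ∪ Ici 2) := by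
  rintro ⟨x, hx⟩
  have hε : (isingBosonMix t).Δ (Sum.inl (Sum.inr isingEpsLabel)) ∈ ({x} ∪ Ici 2 : Set ℝ) :=
    hx _ isingData2D_epsLabel.2.1
  have hε' : (isingBosonMix t).Δ (Sum.inl (Sum.inr isingEpsLabel)) = 1 := isingData2D_epsLabel.1
  have hv : (isingBosonMix t).Δ (Sum.inr (Sum.inr vtxChargeLabel)) ∈ ({x} ∪ Ici 2 : Set ℝ) :=
    hx _ (by show 2 * (0 - 0) = 0; rfl)
  have hv' : (isingBosonMix t).Δ (Sum.inr (Sum.inr vtxChargeLabel)) = 1 / 2 := by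
    show 4 * (1 / 8 : ℝ) + 2 * ((0 : ℕ) : ℝ) + 2 * ((0 : ℕ) : ℝ) = 1 / 2; norm_num
  rw [hε'] at hε
  rw [hv'] at hv
  rcases hε with hε | hε
  · rcases hv with hv | hv
    · rw [mem_singleton_iff] at hε hv; linarith
    · norm_num at hv
  · norm_num at hε

end Summit.CriticalPhenomena.Ising3D.Control2D
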